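import Summits.RiemannHypothesis.RiemannHypothesis.Theorems.PfPersistenceMarkovCore
import HarnessLib

/-!
# PF persistence (theory 1, edge law): THE MARKOV CORE OF A NON-NEGATIVE WEIGHT TABLE, V —
# window test functions are a form core for the table energy (density from above)

Helper file (`--supports stmt-RiemannHypothesis-19953`); mechanism/rigidity campaign; no RH claims.
For EVERY weight table `w` with `w n ≥ 0` on the prime index of the window `[-a, a]`, `a > 0`
(objects in `PfPersistenceMarkovCore`): if `E ∫|h|² ≤ 𝓔^w_a(h)` for every window TEST function,
then `E ∫|u|² ≤ 𝓔^w_a(u)` for every `u` of the finite-energy class `coreAdm a`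
(`table_bottom_mul_le_of_finiteEnergy`; cutoff–shift–mollify).  This is the tree's
`bottom_mul_le_of_finiteEnergy` (route WeilGroundState, there for ζ's weights `Λ(n)/√n`), transported
verbatim: the weights enter only through `w(n) ≥ 0` (mollification does not increase any increment).
It is the density half of the existence of a core ground state for a general table
(`PfPersistenceMarkovCoreExistence`).

## References

* M. Fukushima, Y. Oshima, M. Takeda, *Dirichlet Forms and Symmetric Markov Processes*, 2nd ed.
  (2011), §1.4 Example 1.4.1 (smooth compactly supported functions are a core of a translation
  invariant jump form).
* E. Bombieri, Rend. Mat. Acc. Lincei (9) 11 (2000) 183–233, §4 Thm 3 (minimising sequences; lower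
  semicontinuity of the energy).
* A. Connes, C. Consani, H. Moscovici, *Zeta zeros and prolate wave operators: semilocal adelic
  operators* (2025), Thm 3.6 (compactness of bounded-form sequences on a window).
* M. Reed, B. Simon, *Methods of Modern Mathematical Physics IV* (1978), §XIII.12.
-/

set_option linter.dupNamespace false

noncomputable section

open MeasureTheory Set Filter
open scoped Topology ENNReal NNReal ComplexConjugate ArithmeticFunction.vonMangoldt

namespace Summit.RiemannHypothesis.RiemannHypothesis.Theorems.PfPersistence

open Literature.NumberTheory.LFunctions Literature.NumberTheory.LFunctions.ConnesVanSuijlekom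
open Summit.RiemannHypothesis.RiemannHypothesis.Theorems.WeilWindowFlowWindowLipschitz
open Summit.RiemannHypothesis.RiemannHypothesis.Theorems.WeilGroundStateMarkovPart
open Summit.RiemannHypothesis.RiemannHypothesis.Theorems.PfPersistenceDownCone (zetaTable)

/-! ## Window test functions are a form core for the table energy (density from above) -/

/-- **One mollification step** (the tree's `bottom_mul_le_of_margin` for a non-negative table). If
`E ∫|h|² ≤ 𝓔^w_a(h)` for window test functions and `v ∈ L²` vanishes off the SMALLER window
`[-(a − δ), a − δ]`, `δ > 0`, with finite archimedean energy, then `E ∫|v|² ≤ 𝓔^w_a(v)` (mollify `v`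
with radius `< δ`: a window test function with smaller increments and almost the same norm).
[cite: FukushimaOshimaTakeda2011, §1.4 Example 1.4.1] -/
theorem table_bottom_mul_le_of_margin {a E δ : ℝ} {w : ℕ → ℝ}
    (hw : ∀ n ∈ weilPrimeIndex a, 0 ≤ w n) (hδ : 0 < δ)
    (hE : ∀ h : ℝ → ℂ, IsWeilTest h → tsupport h ⊆ Icc (-a) a →
      E * ∫ x, ‖h x‖ ^ 2 ≤ tableDirichletEnergy a w h)
    {v : ℝ → ℂ} (hv : MemLp v 2) (hvs : ∀ x, x ∉ Icc (-(a - δ)) (a - δ) → v x = 0)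
    (hfin : IntegrableOn (fun t ↦ weilArchDensity t * weilIncrement v t) (Ioi 0)) :
    E * ∫ x, ‖v x‖ ^ 2 ≤ tableDirichletEnergy a w v := by
  obtain ⟨g, hg, hgs, hD, hlim⟩ := exists_mollified_seq hv hvs
  have hgm : ∀ n, MemLp (g n) 2 := fun n ↦ (hg n).memLp_two
  obtain ⟨N, hN⟩ := exists_nat_one_div_lt hδ
  -- for `n ≥ N` the mollified function is a window test function with smaller energy
  have hev : ∀ᶠ n in atTop, E * ∫ x, ‖g n x‖ ^ 2 ≤ tableDirichletEnergy a w v := by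
    refine eventually_atTop.2 ⟨N, fun n hn ↦ ?_⟩
    have hr : 1 / ((n : ℝ) + 1) ≤ δ := by
      have h1 : 1 / ((n : ℝ) + 1) ≤ 1 / ((N : ℝ) + 1) :=
        one_div_le_one_div_of_le (by positivity) (by exact_mod_cast Nat.add_le_add_right hn 1)
      linarith
    have hsupp : tsupport (g n) ⊆ Icc (-a) a :=
      (hgs n).trans (Icc_subset_Icc (by linarith) (by linarith))
    refine (hE (g n) (hg n) hsupp).trans ?_
    unfold tableDirichletEnergy
    refine add_le_add (Finset.sum_le_sum fun k hk ↦ mul_le_mul_of_nonneg_left (hD n _)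
      (hw k hk)) ?_
    refine integral_mono_of_nonneg ?_ hfin ?_
    · exact (ae_restrict_iff' measurableSet_Ioi).2 (Eventually.of_forall fun t ht ↦
        mul_nonneg (weilArchDensity_pos ht).le (weilIncrement_nonneg _ t))
    · exact (ae_restrict_iff' measurableSet_Ioi).2 (Eventually.of_forall fun t ht ↦
        mul_le_mul_of_nonneg_left (hD n t) (weilArchDensity_pos ht).le)
  have hN2 : Tendsto (fun n ↦ E * ∫ x, ‖g n x‖ ^ 2) atTop (𝓝 (E * ∫ x, ‖v x‖ ^ 2)) :=
    (tendsto_integral_norm_sq hv hgm hlim).const_mul E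
  exact le_of_tendsto hN2 hev

/-- **Window test functions are a form core for `𝓔^w_a` (density from above)** — the tree's
`bottom_mul_le_of_finiteEnergy` for a non-negative table. Let `a > 0` and suppose
`E ∫|h|² ≤ 𝓔^w_a(h)` for every test function `h` with `tsupport h ⊆ [-a, a]`. Then
`E ∫|u|² ≤ 𝓔^w_a(u)` for every `u ∈ L²` vanishing off `[-a, a]` with finite archimedean energy
(cutoff–shift–mollify). [cite: FukushimaOshimaTakeda2011, §1.4 Example 1.4.1] -/
theorem table_bottom_mul_le_of_finiteEnergy {a E : ℝ} {w : ℕ → ℝ}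
    (hw : ∀ n ∈ weilPrimeIndex a, 0 ≤ w n) (ha : 0 < a)
    (hE : ∀ h : ℝ → ℂ, IsWeilTest h → tsupport h ⊆ Icc (-a) a →
      E * ∫ x, ‖h x‖ ^ 2 ≤ tableDirichletEnergy a w h)
    {u : ℝ → ℂ} (hu : MemLp u 2) (hus : ∀ x, x ∉ Icc (-a) a → u x = 0)
    (hfin : IntegrableOn (fun t ↦ weilArchDensity t * weilIncrement u t) (Ioi 0)) :
    E * ∫ x, ‖u x‖ ^ 2 ≤ tableDirichletEnergy a w u := by
  obtain ⟨β, L, hβc, hβ01, hL, hβL, hβ1, hβ0⟩ := exists_window_cutoff ha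
  -- the two pieces
  set w₁ : ℝ → ℂ := fun x ↦ (β x : ℂ) * u x with hw₁def
  set w₂ : ℝ → ℂ := fun x ↦ ((1 - β x : ℝ) : ℂ) * u x with hw₂def
  have hsum : ∀ x, w₁ x + w₂ x = u x := fun x ↦ by
    simp only [hw₁def, hw₂def]; push_cast; ring
  have hβ01' : ∀ x, 0 ≤ 1 - β x ∧ 1 - β x ≤ 1 := fun x ↦
    ⟨by linarith [(hβ01 x).2], by linarith [(hβ01 x).1]⟩
  have hβL' : ∀ x y, |(1 - β x) - (1 - β y)| ≤ L * |x - y| := fun x y ↦ by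
    rw [show (1 - β x) - (1 - β y) = β y - β x by ring, abs_sub_comm]; exact hβL x y
  have hw₁m : MemLp w₁ 2 :=
    stub_localizedCut_memLp_mul hu hβc fun x ↦ abs_le.2 ⟨by linarith [(hβ01 x).1], (hβ01 x).2⟩
  have hw₂m : MemLp w₂ 2 :=
    stub_localizedCut_memLp_mul hu (continuous_const.sub hβc)
      fun x ↦ abs_le.2 ⟨by linarith [(hβ01' x).1], (hβ01' x).2⟩
  have hw₁e : IntegrableOn (fun t ↦ weilArchDensity t * weilIncrement w₁ t) (Ioi 0) :=
    stub_localizedCut_finiteEnergy_mul hu hβc hβ01 hL hβL hfin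
  have hw₂e : IntegrableOn (fun t ↦ weilArchDensity t * weilIncrement w₂ t) (Ioi 0) :=
    stub_localizedCut_finiteEnergy_mul hu (continuous_const.sub hβc) hβ01' hL hβL' hfin
  -- supports of the pieces
  have hw₁s : ∀ x, (x < -a ∨ a / 4 ≤ x) → w₁ x = 0 := by
    rintro x (hx | hx)
    · simp only [hw₁def, hus x fun h ↦ by linarith [h.1], mul_zero]
    · simp only [hw₁def, hβ0 x hx, Complex.ofReal_zero, zero_mul]
  have hw₂s : ∀ x, (x ≤ -a / 4 ∨ a < x) → w₂ x = 0 := by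
    rintro x (hx | hx)
    · by_cases hxa : -a ≤ x
      · simp only [hw₂def, hβ1 x hxa hx, sub_self, Complex.ofReal_zero, zero_mul]
      · simp only [hw₂def, hus x fun h ↦ hxa h.1, mul_zero]
    · simp only [hw₂def, hus x fun h ↦ by linarith [h.2], mul_zero]
  have hw₁s' : ∀ x, x ∉ Icc (-a) a → w₁ x = 0 := fun x hx ↦ by
    rcases lt_or_ge x (-a) with h | h
    · exact hw₁s x (Or.inl h)
    · exact hw₁s x (Or.inr (by
        have : ¬ x ≤ a := fun h' ↦ hx ⟨h, h'⟩
        linarith))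
  have hw₂s' : ∀ x, x ∉ Icc (-a) a → w₂ x = 0 := fun x hx ↦ by
    rcases lt_or_ge x (-a) with h | h
    · exact hw₂s x (Or.inl (by linarith))
    · exact hw₂s x (Or.inr (not_le.1 fun h' ↦ hx ⟨h, h'⟩))
  -- the shifted functions
  set δ : ℕ → ℝ := fun m ↦ a / (4 * ((m : ℝ) + 1)) with hδdef
  have hδpos : ∀ m, 0 < δ m := fun m ↦ by positivity
  have hδle : ∀ m, δ m ≤ a / 4 := fun m ↦ by
    rw [hδdef]
    exact div_le_div_of_nonneg_left ha.le (by norm_num) (by nlinarith [m.cast_nonneg (α := ℝ)])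
  set v : ℕ → ℝ → ℂ := fun m x ↦ w₁ (x - δ m) + w₂ (x - (-δ m)) with hvdef
  have hvm : ∀ m, MemLp (v m) 2 := fun m ↦ (memLp_shift hw₁m _).add (memLp_shift hw₂m _)
  have hvs : ∀ m x, x ∉ Icc (-(a - δ m)) (a - δ m) → v m x = 0 := by
    intro m x hx
    have hd := hδle m
    have hd0 := hδpos m
    rcases lt_or_ge x (-(a - δ m)) with h | h
    · simp only [hvdef]
      rw [hw₁s _ (Or.inl (by linarith)), hw₂s _ (Or.inl (by linarith)), add_zero]
    · have h' : a - δ m < x := not_le.1 fun h'' ↦ hx ⟨h, h''⟩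
      simp only [hvdef]
      rw [hw₁s _ (Or.inr (by linarith)), hw₂s _ (Or.inr (by linarith)), add_zero]
  have hvD : ∀ m t, weilIncrement (v m) t ≤ 2 * weilIncrement w₁ t + 2 * weilIncrement w₂ t := by
    intro m t
    have h := weilIncrement_add_le (memLp_shift hw₁m (δ m)) (memLp_shift hw₂m (-δ m)) t
    rw [weilIncrement_shift, weilIncrement_shift] at h
    exact h
  have hve : ∀ m, IntegrableOn (fun t ↦ weilArchDensity t * weilIncrement (v m) t) (Ioi 0) := by
    intro m
    refine Integrable.mono' ((hw₁e.const_mul 2).add (hw₂e.const_mul 2))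
      (measurable_weilArchDensity.aestronglyMeasurable.mul
        (stub_localizedCut_aesm_weilIncrement (hvm m).1)).restrict ?_
    refine (ae_restrict_iff' measurableSet_Ioi).2 (Eventually.of_forall fun t (ht : 0 < t) ↦ ?_)
    rw [Real.norm_of_nonneg (mul_nonneg (weilArchDensity_pos ht).le (weilIncrement_nonneg _ t))]
    have := mul_le_mul_of_nonneg_left (hvD m t) (weilArchDensity_pos ht).le
    simp only [Pi.add_apply]
    linarith
  -- the bound for each shifted function
  have hvE : ∀ m, E * ∫ x, ‖v m x‖ ^ 2 ≤ tableDirichletEnergy a w (v m) := fun m ↦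
    table_bottom_mul_le_of_margin hw (hδpos m) hE (hvm m) (hvs m) (hve m)
  -- `v m → u` in `L²`
  have hδ0 : Tendsto δ atTop (𝓝 0) := by
    have h := (tendsto_one_div_add_atTop_nhds_zero_nat (𝕜 := ℝ)).const_mul (a / 4)
    rw [mul_zero] at h
    refine h.congr fun m ↦ ?_
    simp only [hδdef]
    field_simp
  have hL2 : Tendsto (fun m ↦ ∫ x, ‖v m x - u x‖ ^ 2) atTop (𝓝 0) := by
    have hb : ∀ m, ∫ x, ‖v m x - u x‖ ^ 2 ≤
        2 * weilIncrement w₁ (-δ m) + 2 * weilIncrement w₂ (- -δ m) := by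
      intro m
      have hA : MemLp (fun x ↦ w₁ (x - δ m) - w₁ x) 2 := (memLp_shift hw₁m (δ m)).sub hw₁m
      have hB : MemLp (fun x ↦ w₂ (x - -δ m) - w₂ x) 2 := (memLp_shift hw₂m (-δ m)).sub hw₂m
      have h := integral_norm_sq_add_le hA hB
      rw [integral_norm_sq_shift_sub, integral_norm_sq_shift_sub] at h
      refine le_trans (le_of_eq (integral_congr_ae (Eventually.of_forall fun x ↦ ?_))) h
      simp only [hvdef, ← hsum x]
      ring_nf
    have h1 : Tendsto (fun m ↦ weilIncrement w₁ (-δ m)) atTop (𝓝 0) :=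
      (tendsto_weilIncrement_nhds_zero hw₁m hw₁s').comp (by simpa using hδ0.neg)
    have h2 : Tendsto (fun m ↦ weilIncrement w₂ (- -δ m)) atTop (𝓝 0) :=
      (tendsto_weilIncrement_nhds_zero hw₂m hw₂s').comp (by simpa using hδ0)
    refine squeeze_zero (fun m ↦ integral_nonneg fun _ ↦ by positivity) hb ?_
    simpa using (h1.const_mul 2).add (h2.const_mul 2)
  -- the energies converge
  have hD : ∀ t, Tendsto (fun m ↦ weilIncrement (v m) t) atTop (𝓝 (weilIncrement u t)) :=
    tendsto_weilIncrement_of_tendsto hu hvm hL2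
  have hEn : Tendsto (fun m ↦ tableDirichletEnergy a w (v m)) atTop
      (𝓝 (tableDirichletEnergy a w u)) := by
    refine Tendsto.add (tendsto_finsetSum _ fun n _ ↦ (hD (Real.log n)).const_mul _) ?_
    refine tendsto_integral_of_dominated_convergence
      (fun t ↦ 2 * (weilArchDensity t * weilIncrement w₁ t) +
        2 * (weilArchDensity t * weilIncrement w₂ t))
      (fun m ↦ (measurable_weilArchDensity.aestronglyMeasurable.mul
        (stub_localizedCut_aesm_weilIncrement (hvm m).1)).restrict)
      ((hw₁e.const_mul 2).add (hw₂e.const_mul 2)) (fun m ↦ ?_)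
      (Eventually.of_forall fun t ↦ (hD t).const_mul _)
    refine (ae_restrict_iff' measurableSet_Ioi).2 (Eventually.of_forall fun t (ht : 0 < t) ↦ ?_)
    rw [Real.norm_of_nonneg (mul_nonneg (weilArchDensity_pos ht).le (weilIncrement_nonneg _ t))]
    have := mul_le_mul_of_nonneg_left (hvD m t) (weilArchDensity_pos ht).le
    linarith
  -- pass to the limit
  have hN : Tendsto (fun m ↦ E * ∫ x, ‖v m x‖ ^ 2) atTop (𝓝 (E * ∫ x, ‖u x‖ ^ 2)) :=
    (tendsto_integral_norm_sq hu hvm hL2).const_mul E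
  exact le_of_tendsto_of_tendsto' hN hEn hvE

end Summit.RiemannHypothesis.RiemannHypothesis.Theorems.PfPersistence

end
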